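import Literature.AlgebraicGeometry.Frobenioids.Cor412Unconditional
import Literature.AlgebraicGeometry.Frobenioids.ArithmeticFrobenioidFrobeniusCompact
import Literature.AlgebraicGeometry.Frobenioids.ArithmeticFrobenioidsProofs
import Literature.AlgebraicGeometry.Frobenioids.FinSubextCatFSM
import Literature.AlgebraicGeometry.Frobenioids.FinSubextCatFrobeniusSlim
import HarnessLib

/-!
# Frobenioids I, Corollary 4.12 at the arithmetic Frobenioids `C_{K/F}` of §6 — hypothesis-free

Mochizuki, *The geometry of Frobenioids I: the general theory*, Kyushu J. Math. **62** (2008) 293–400,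
Corollary 4.12 p. 95, applied at the motivating example of Example 6.3 / Theorem 6.4 (pp. 113–115): the
arithmetic Frobenioid `C_{K/F}` of a Galois extension `K/F` of a number field, over the base category
`D = B(Gal(K/F))⁰` of finite subextensions. [cite: MochizukiFrdI2008, Cor. 4.12 p.95]
[cite: MochizukiFrdI2008, Thm. 6.4 (i) p.114]

Proof-only file (node FrdI:Cor4.12, genuine-data instance; seat abc-iut-w5-d222, W9 lineage), 0 definitions.
Every antecedent of the typed Cor. 4.12 (`PreFrobenioidData.Cor412`) is a theorem of the tree at `C_{K/F}`:

* the base `D` is of FSM-type (abc-iut-L1-t3 lineage, `FinSubextCat.isOfFSMType`) — so this lineage's closer at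
  THE Def. 4.5 (iii) parameters applies (`FrdI.cor412_of_isOfFSMType_canonical'`, definitionally the `rsParams` form
  `FrdI.cor412_rsParams_of_isOfFSMType`; `Cor412Unconditional.lean`);
* `D` is Frobenius-slim (`FinSubextCat.isFrobeniusSlim`, via residual finiteness of `Aut(D_A → D)`);
* `C_{K/F}` is of rationally standard type at THE parameters (Thm. 6.4 (i); abc-iut-w5-d250 / L6-t10 lineage,
  `arithFrobenioid_isOfRationallyStandardType_rsParams` — Frobenius-compact object of `(C^un-tr)^birat` included);
* hypothesis (b) is vacuous: `C_{K/F}` is not of group-like type (`not_isOfGroupLikeType_arith`, the archimedean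
  divisor).

Hence `FrdI.cor412_conclusion_arith`: **for EVERY equivalence of categories `Ψ : C_{K₁/F₁} ⥲ C_{K₂/F₂}` between
arithmetic Frobenioids there is a `1`-unique functor `Ψ⁰ : D₁ × ℕ_{≥1} → D₂ × ℕ_{≥1}` (an equivalence) that
`1`-commutes with `Ψ` over the natural projections `C_{K_i/F_i} → F_{0_{D_i}} = D_i × ℕ_{≥1}`; if the `D_i` are
slim, the composites `C_{K₁/F₁} → D₂ × ℕ_{≥1}` are rigid** — a statement with no hypothesis left, i.e. a
genuine-data witness that the antecedent package of the cell's Cor. 4.12 closer is inhabited (kind NV in the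
cell's bookkeeping). No statement of the paper is restated or strengthened; nothing here bears on
[IUTchIII] Cor. 3.12.
-/

noncomputable section

namespace Literature.AlgebraicGeometry.Frobenioids

open CategoryTheory Opposite
open PreFrobenioid

namespace FrdI

section Arith

variable (F₁ : Type) [Field F₁] [NumberField F₁] (K₁ : Type) [Field K₁] [Algebra F₁ K₁] [IsGalois F₁ K₁]
variable (F₂ : Type) [Field F₂] [NumberField F₂] (K₂ : Type) [Field K₂] [Algebra F₂ K₂] [IsGalois F₂ K₂]

/-- **[FrdI] Cor. 4.12 for a pair of arithmetic Frobenioids `C_{K₁/F₁}`, `C_{K₂/F₂}` and any equivalence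
`Ψ` between them, at THE Def. 4.5 (iii) parameters** (support = the primary support `PrimarySupp` of
Def. 2.4 (i)(d)) — the typed statement with its printed antecedents, no further input: the bases
`B(Gal(K_i/F_i))⁰` are of FSM-type. [cite: MochizukiFrdI2008, Cor. 4.12 p.95] -/
theorem cor412_arith (Ψ : arithFrobenioid F₁ K₁ ≌ arithFrobenioid F₂ K₂) :
    (arithFrobenioidOps F₁ K₁).Cor412 (arithFrobenioidOps F₂ K₂) Ψ
      (rsParams (arithFrobenioid_isFrobenioid F₁ K₁) fun a 𝔭 => PrimarySupp a 𝔭)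
      (rsParams (arithFrobenioid_isFrobenioid F₂ K₂) fun a 𝔭 => PrimarySupp a 𝔭) :=
  cor412_of_isOfFSMType_canonical' (arithFrobenioid_isFrobenioid F₁ K₁) (arithFrobenioid_isFrobenioid F₂ K₂)
    (FinSubextCat.isOfFSMType F₁ K₁) (FinSubextCat.isOfFSMType F₂ K₂) Ψ _ _

/-- **[FrdI] Cor. 4.12 at `C_{K/F}` — the CONCLUSION, hypothesis-free.** For every equivalence of categories
`Ψ : C_{K₁/F₁} ⥲ C_{K₂/F₂}` between the arithmetic Frobenioids of Galois extensions `K_i/F_i` of number fields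
there is a functor `Ψ⁰ : D₁ × ℕ_{≥1} ⥤ D₂ × ℕ_{≥1}` (`D_i = B(Gal(K_i/F_i))⁰`), an equivalence, `1`-commuting with
`Ψ` over the natural projections `C_{K_i/F_i} → D_i × ℕ_{≥1}` and `1`-unique with this property; if moreover
`D₁`, `D₂` are slim, the composites `C_{K₁/F₁} → D₂ × ℕ_{≥1}` are rigid. All three printed antecedents of Cor. 4.12
are discharged at this data: Frobenius-slim bases (`FinSubextCat.isFrobeniusSlim`), rationally standard type
at THE parameters (Thm. 6.4 (i), `arithFrobenioid_isOfRationallyStandardType_rsParams`), and hypothesis (b),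
vacuous since `C_{K/F}` is not of group-like type (`not_isOfGroupLikeType_arith`).
[cite: MochizukiFrdI2008, Cor. 4.12 p.95] [cite: MochizukiFrdI2008, Thm. 6.4 (i) p.114] -/
theorem cor412_conclusion_arith (Ψ : arithFrobenioid F₁ K₁ ≌ arithFrobenioid F₂ K₂) :
    ∃ Ψ0 : FinSubextCat F₁ K₁ × SingleObj ℕ+ ⥤ FinSubextCat F₂ K₂ × SingleObj ℕ+,
      PreFrobenioidData.OneUniqueSquare Ψ.functor (arithFrobenioidOps F₁ K₁).toBaseDeg
          (arithFrobenioidOps F₂ K₂).toBaseDeg Ψ0 ∧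
        (IsSlim (FinSubextCat F₁ K₁) → IsSlim (FinSubextCat F₂ K₂) →
          IsRigidFunctor (Ψ.functor ⋙ (arithFrobenioidOps F₂ K₂).toBaseDeg) ∧
            IsRigidFunctor ((arithFrobenioidOps F₁ K₁).toBaseDeg ⋙ Ψ0)) :=
  cor412_arith F₁ K₁ F₂ K₂ Ψ (FinSubextCat.isFrobeniusSlim F₁ K₁) (FinSubextCat.isFrobeniusSlim F₂ K₂)
    (arithFrobenioid_isOfRationallyStandardType_rsParams F₁ K₁)
    (arithFrobenioid_isOfRationallyStandardType_rsParams F₂ K₂)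
    (fun h₁ _ => absurd h₁ (not_isOfGroupLikeType_arith F₁ K₁))

/-- In particular, for every number field `F` with Galois extension `K` and every self-equivalence `Ψ` of
`C_{K/F}` (e.g. the identity), the `1`-unique `Ψ⁰` of Cor. 4.12 exists — a genuine-data inhabitant of the
conclusion of the typed Cor. 4.12. [cite: MochizukiFrdI2008, Cor. 4.12 p.95] -/
theorem cor412_conclusion_arith_self (Ψ : arithFrobenioid F₁ K₁ ≌ arithFrobenioid F₁ K₁) :
    ∃ Ψ0 : FinSubextCat F₁ K₁ × SingleObj ℕ+ ⥤ FinSubextCat F₁ K₁ × SingleObj ℕ+,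
      PreFrobenioidData.OneUniqueSquare Ψ.functor (arithFrobenioidOps F₁ K₁).toBaseDeg
          (arithFrobenioidOps F₁ K₁).toBaseDeg Ψ0 :=
  let ⟨Ψ0, h, _⟩ := cor412_conclusion_arith F₁ K₁ F₁ K₁ Ψ
  ⟨Ψ0, h⟩

end Arith

end FrdI

end Literature.AlgebraicGeometry.Frobenioids

end
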